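import Literature.MathematicalPhysics.QuantumLattice.LTQOProofs
import Literature.MathematicalPhysics.QuantumLattice.FinDimSpectrumClusterGapProofs
import HarnessLib

/-!
# Frustration-free projector Hamiltonians: kernels, local gaps and LTQO transfer

Sibling proof file of `Literature/MathematicalPhysics/QuantumLattice/LTQO.lean`. It proves the
elementary structural facts of Michalakis–Zwolak, *Stability of frustration-free Hamiltonians*,
CMP **322** (2013) 277 = arXiv:1109.1588, §4 (Definition 3, Corollary 1, the Local-Gap
condition of Definition 5) in the vocabulary of `LTQO.lean` (`localGroundSpace`,
`localGroundProj`, `ltqoConst`, `HasLTQO`, `HasLocalGap`), as the second layer of the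
formalisation of the stability theorem `michalakis_zwolak` (hubbard.S19). No definition and no
named fact is introduced (theorems only).

Contents:

* spectral subspaces (general Hermitian matrices, complement of
  `FinDimSpectrumClusterGapProofs`): the eigenspace is the span of the eigenvectors with that
  eigenvalue (`eigenspace_toEuclideanLin_eq_span`), the orthogonal complement of a span of
  eigenvectors is the span of the others (`orthogonal_span_eigenvectorBasis`), and the
  **gap form bound** `b‖x‖² ≤ re ⟪x, A x⟫` on the orthogonal complement of the low cluster when
  every eigenvalue is `≤ a` or `≥ b` (`mul_norm_sq_le_re_inner_of_mem_orthogonal_span`);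
* projector interactions (`IsProjectorInteraction`): terms and local Hamiltonians are positive
  semidefinite; `H_B ψ = 0 ↔ ψ ∈ localGroundSpace Φ B` (MZ13 Definition 3: for frustration-free
  projector Hamiltonians `P_B` projects onto the common kernel); `H_B P_B = 0 = P_B H_B`;
* **MZ13 Corollary 1 (1) under the Local-Gap condition**: if `H_B` has the cluster gap
  `HasClusterGap H_B (dim localGroundSpace) 0 g` (this is `HasLocalGap` at one ball) then
  `re ⟪x, H_B x⟫ ≥ g ‖x − P_B x‖²` for every `x`, i.e. `H_B ≥ g (1 − P_B)`
  (`re_inner_localHamiltonian_ge_of_hasClusterGap`);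
* **LTQO transfer to larger regions** (used in MZ13 Lemma 3 with the whole torus): since
  `P_{B'} P_B = P_{B'}` for `B ⊆ B'` (`localGroundProj_mul_of_subset_holds`), the LTQO estimate
  `‖P_B O P_B − c P_B‖ ≤ η` implies `‖P_{B'} O P_{B'} − c P_{B'}‖ ≤ η` with the *same* constant
  (`HasLTQO.norm_conj_sub_smul_le_of_subset`); in particular the global ground-state projection
  of a frustration-free family inherits local indistinguishability from the non-wrapping balls of
  `HasLTQO`.

Sources: MZ13 §4, Definition 3 and Corollary 1 (arXiv:1109.1588 p. 7: "`H_B ≥ ε(1 − P_B(ε))`",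
"`P_B(ε) P_C(0) = P_C(0)` for `B ⊂ C`"), Definition 5 (p. 8, Local-Gap), Lemma 3 (p. 12:
"From Local-TQO we know that for `r ≤ L*`, `‖P₀ X̃_u(r) P₀‖ ≤ ‖X_u(r)‖ Δ₀(L − r)`").
-/

noncomputable section

open Matrix Finset Module
open scoped InnerProductSpace ComplexOrder Matrix.Norms.L2Operator

namespace Literature.MathematicalPhysics.QuantumLattice

open Literature.Probability.LatticeModels

/-! ### Spectral subspaces of a Hermitian matrix -/

section Spectral

variable {n : Type*} [Fintype n] [DecidableEq n]

/-- The eigenspace of a Hermitian matrix for `μ` is the span of the basis eigenvectors with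
eigenvalue `μ` (both have dimension `#{i | λᵢ = μ}`, `IsHermitian.card_filter_eigenvalues_eq`).
[folklore] -/
theorem eigenspace_toEuclideanLin_eq_span {A : Matrix n n ℂ} (hA : A.IsHermitian) (μ : ℝ) :
    Module.End.eigenspace (toEuclideanLin A) (μ : ℂ) =
      Submodule.span ℂ (Set.range fun i : ({i | hA.eigenvalues i = μ} : Finset n) =>
        hA.eigenvectorBasis i) := by
  symm
  apply Submodule.eq_of_le_of_finrank_le
  · rw [Submodule.span_le]
    rintro _ ⟨i, rfl⟩
    have hi : hA.eigenvalues i = μ := (mem_filter.mp i.2).2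
    dsimp only
    rw [SetLike.mem_coe, Module.End.mem_eigenspace_iff,
      Literature.LinearAlgebra.Matrix.toEuclideanLin_eigenvectorBasis hA, hi]
    rfl
  · rw [finrank_eigSpan hA, Matrix.finrank_eigenspace_toEuclideanLin,
      ← hA.card_filter_eigenvalues_eq]

/-- The orthogonal complement of the span of the eigenvectors `uᵢ`, `i ∈ S`, is the span of
the remaining eigenvectors `uᵢ`, `i ∉ S` (orthonormality and a dimension count). [folklore] -/
theorem orthogonal_span_eigenvectorBasis {𝕜 : Type*} [RCLike 𝕜] {A : Matrix n n 𝕜}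
    (hA : A.IsHermitian) (S : Finset n) :
    (Submodule.span 𝕜 (Set.range fun i : S => hA.eigenvectorBasis i))ᗮ =
      Submodule.span 𝕜 (Set.range fun i : ({i | i ∉ S} : Finset n) => hA.eigenvectorBasis i) := by
  symm
  apply Submodule.eq_of_le_of_finrank_le
  · rw [Submodule.span_le]
    rintro _ ⟨j, rfl⟩
    have hj : (j : n) ∉ S := (mem_filter.mp j.2).2
    dsimp only
    rw [SetLike.mem_coe, Submodule.mem_orthogonal]
    intro w hw
    rw [← inner_conj_symm, inner_eigenvectorBasis_eq_zero_of_mem_eigSpan hA hw hj, map_zero]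
  · have h1 := Submodule.finrank_add_finrank_orthogonal
      (Submodule.span 𝕜 (Set.range fun i : S => hA.eigenvectorBasis i))
    rw [finrank_euclideanSpace, finrank_eigSpan hA] at h1
    rw [finrank_eigSpan hA]
    have h2 := card_filter_add_card_filter_not (s := (univ : Finset n)) (fun i => i ∈ S)
    rw [filter_mem_eq_inter, univ_inter, card_univ] at h2
    omega

/-- **Gap form bound above a separated low cluster.** If every eigenvalue `λᵢ` of the Hermitian
`A` with `i ∉ S` is `≥ b`, then `b‖x‖² ≤ re ⟪x, A x⟫` for every `x` orthogonal to the eigenvectors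
`uᵢ`, `i ∈ S`. Reed–Simon IV §XIII.1; this is the form in which a spectral gap is used in MZ13 §4
Corollary 1 (1). [folklore] -/
theorem mul_norm_sq_le_re_inner_of_mem_orthogonal_span {𝕜 : Type*} [RCLike 𝕜]
    {A : Matrix n n 𝕜} (hA : A.IsHermitian) {S : Finset n} {b : ℝ}
    (hb : ∀ i, i ∉ S → b ≤ hA.eigenvalues i) {x : EuclideanSpace 𝕜 n}
    (hx : x ∈ (Submodule.span 𝕜 (Set.range fun i : S => hA.eigenvectorBasis i))ᗮ) :
    b * ‖x‖ ^ 2 ≤ RCLike.re ⟪x, toEuclideanLin A x⟫_𝕜 := by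
  rw [orthogonal_span_eigenvectorBasis hA] at hx
  refine mul_norm_sq_le_re_inner_of_mem_eigSpan hA (fun i hi => ?_) hx
  exact hb i (mem_filter.mp hi).2

/-- Under a cluster gap of width `0`, `A.HasClusterGap m 0 g`, the quadratic form is
`≥ (E₀ + g)‖x‖²` on the orthogonal complement of the ground eigenspace `ker (A − E₀)`,
`E₀ = ⨅ᵢ λᵢ` (the ground eigenspace is the span of the eigenvectors with `λᵢ = E₀`, and every
other eigenvalue is `≥ E₀ + g`). MZ13 §4 Corollary 1 (1)/(4) (arXiv:1109.1588 p. 7). [folklore] -/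
theorem HasClusterGap.mul_norm_sq_le_re_inner_of_mem_orthogonal {A : Matrix n n ℂ} {m : ℕ}
    {g : ℝ} (h : A.HasClusterGap m 0 g) {x : EuclideanSpace ℂ n}
    (hx : x ∈ (Module.End.eigenspace (toEuclideanLin A)
      ((⨅ j, h.isHermitian.eigenvalues j : ℝ) : ℂ))ᗮ) :
    ((⨅ j, h.isHermitian.eigenvalues j) + g) * ‖x‖ ^ 2 ≤
      RCLike.re ⟪x, toEuclideanLin A x⟫_ℂ := by
  have hA : A.IsHermitian := h.isHermitian
  have hsep := h.2.2.2.2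
  have hbdd : BddBelow (Set.range hA.eigenvalues) := (Set.finite_range _).bddBelow
  rw [eigenspace_toEuclideanLin_eq_span hA] at hx
  refine mul_norm_sq_le_re_inner_of_mem_orthogonal_span hA (fun i hi => ?_) hx
  have hne : hA.eigenvalues i ≠ ⨅ j, hA.eigenvalues j := fun heq => hi (by simp [heq])
  rcases hsep i with h1 | h1
  · exact absurd (le_antisymm (by simpa only [add_zero] using h1) (ciInf_le hbdd i)) hne
  · simpa only [add_zero] using h1

end Spectral

/-! ### Projector interactions: positivity and kernels -/

section Projector

variable {Λ : Type*} [Fintype Λ] [DecidableEq Λ] {q : ℕ}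

/-- The terms of a projector interaction are positive semidefinite: `Φ X = (Φ X)ᴴ (Φ X)`.
MZ13 §2 ("`Q_u ≥ 0`", arXiv:1109.1588 p. 7, proof of Corollary 4). [folklore] -/
theorem IsProjectorInteraction.posSemidef_apply {Φ : Interaction Λ q}
    (h : IsProjectorInteraction Φ) (X : Finset Λ) : (Φ X).PosSemidef := by
  have h1 : Φ X = (Φ X)ᴴ * Φ X := by rw [(h X).1.eq, (h X).2]
  rw [h1]
  exact posSemidef_conjTranspose_mul_self _

/-- The local Hamiltonians of a projector interaction are positive semidefinite.
MZ13 §2/§4 (`H_B = Σ Q_v ≥ 0`). [folklore] -/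
theorem IsProjectorInteraction.posSemidef_localHamiltonian {Φ : Interaction Λ q}
    (h : IsProjectorInteraction Φ) (B : Finset Λ) : (localHamiltonian Φ B).PosSemidef :=
  posSemidef_sum _ fun X _ => h.posSemidef_apply X

/-- Every local Hamiltonian annihilates the local ground space (the common kernel of its terms;
no assumption on `Φ`). MZ13 §4 Definition 3 (`H_B P_B = 0`). [folklore] -/
theorem localHamiltonian_mulVec_of_mem_localGroundSpace (Φ : Interaction Λ q) {B : Finset Λ}
    {ψ : TensorIndex Λ q → ℂ} (hψ : ψ ∈ localGroundSpace Φ B) :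
    localHamiltonian Φ B *ᵥ ψ = 0 := by
  rw [mem_localGroundSpace_iff] at hψ
  rw [localHamiltonian, sum_mulVec]
  exact sum_eq_zero fun X hX => hψ X (mem_powerset.mp hX)

/-- **The kernel of a frustration-free projector Hamiltonian is the common kernel of its terms**:
for a projector interaction, `H_B ψ = 0 ↔ ψ ∈ localGroundSpace Φ B` (each `⟨ψ, Φ X ψ⟩ ≥ 0`
and their sum vanishes). MZ13 §4 Definition 3 (`P_B := P_B(0)`, the projection onto the
zero-energy eigenstates of `H_B`) for frustration-free projector Hamiltonians.
[cite: MichalakisZwolakCMP2013, §4 Definition 3 (arXiv:1109.1588 p. 7)] -/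
theorem IsProjectorInteraction.localHamiltonian_mulVec_eq_zero_iff {Φ : Interaction Λ q}
    (h : IsProjectorInteraction Φ) (B : Finset Λ) (ψ : TensorIndex Λ q → ℂ) :
    localHamiltonian Φ B *ᵥ ψ = 0 ↔ ψ ∈ localGroundSpace Φ B := by
  refine ⟨fun h0 => ?_, localHamiltonian_mulVec_of_mem_localGroundSpace Φ⟩
  rw [mem_localGroundSpace_iff]
  have hsum : ∑ X ∈ B.powerset, star ψ ⬝ᵥ (Φ X *ᵥ ψ) = 0 := by
    rw [← dotProduct_sum, ← sum_mulVec, ← localHamiltonian, h0, dotProduct_zero]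
  have hnonneg : ∀ X ∈ B.powerset, 0 ≤ star ψ ⬝ᵥ (Φ X *ᵥ ψ) :=
    fun X _ => (h.posSemidef_apply X).dotProduct_mulVec_nonneg ψ
  have hzero := (sum_eq_zero_iff_of_nonneg hnonneg).mp hsum
  intro X hX
  exact ((h.posSemidef_apply X).dotProduct_mulVec_zero_iff ψ).mp (hzero X (mem_powerset.mpr hX))

/-- Kernel form: `ker H_B = localGroundSpace Φ B` for a projector interaction.
[cite: MichalakisZwolakCMP2013, §4 Definition 3 (arXiv:1109.1588 p. 7)] -/
theorem IsProjectorInteraction.ker_toLin'_localHamiltonian {Φ : Interaction Λ q}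
    (h : IsProjectorInteraction Φ) (B : Finset Λ) :
    LinearMap.ker (toLin' (localHamiltonian Φ B)) = localGroundSpace Φ B := by
  ext ψ
  rw [LinearMap.mem_ker, toLin'_apply, h.localHamiltonian_mulVec_eq_zero_iff]

/-- `H_B P_B = 0`: the local Hamiltonian kills the local ground-state projection (its columns
lie in the local ground space; no assumption on `Φ`). MZ13 §4 (`H_B P_B = 0`). [folklore] -/
theorem localHamiltonian_mul_localGroundProj (Φ : Interaction Λ q) (B : Finset Λ) :
    localHamiltonian Φ B * localGroundProj Φ B = 0 := by
  rw [ext_iff_mulVec]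
  intro v
  rw [← mulVec_mulVec, zero_mulVec]
  exact localHamiltonian_mulVec_of_mem_localGroundSpace Φ (projMatrix_map_mulVec_mem _ v)

/-- `P_B H_B = 0` for a local (hence Hermitian) interaction (adjoint of
`localHamiltonian_mul_localGroundProj`). MZ13 §4. [folklore] -/
theorem localGroundProj_mul_localHamiltonian {Φ : Interaction Λ q} (B : Finset Λ)
    (hH : (localHamiltonian Φ B).IsHermitian) :
    localGroundProj Φ B * localHamiltonian Φ B = 0 := by
  rw [← (localGroundProj_isHermitian Φ B).eq, ← hH.eq, ← conjTranspose_mul,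
    localHamiltonian_mul_localGroundProj, conjTranspose_zero]

end Projector

/-! ### MZ13 Corollary 1 (1) under the Local-Gap condition: `H_B ≥ g (1 − P_B)` -/

section LocalGap

variable {Λ : Type*} [Fintype Λ] [DecidableEq Λ] {q : ℕ}

/-- The transported local ground space (the subspace of `EuclideanSpace` whose orthogonal
projection is `localGroundProj Φ B`) is the zero eigenspace of `H_B` on `EuclideanSpace`, for
a projector interaction. [folklore] -/
theorem IsProjectorInteraction.map_localGroundSpace_eq_eigenspace {Φ : Interaction Λ q}
    (h : IsProjectorInteraction Φ) (B : Finset Λ) :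
    (localGroundSpace Φ B).map
        ((WithLp.linearEquiv 2 ℂ (TensorIndex Λ q → ℂ)).symm :
          (TensorIndex Λ q → ℂ) →ₗ[ℂ] EuclideanSpace ℂ (TensorIndex Λ q)) =
      Module.End.eigenspace (toEuclideanLin (localHamiltonian Φ B)) 0 := by
  rw [Matrix.eigenspace_toEuclideanLin_eq_map, Module.End.eigenspace_zero,
    h.ker_toLin'_localHamiltonian]

/-- For a projector interaction whose local Hamiltonian `H_B` has the cluster gap
`HasClusterGap H_B (dim localGroundSpace Φ B) 0 g` (the Local-Gap condition at the region
`B`), the least eigenvalue of `H_B` is `0` as soon as the configuration space is non-empty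
(`H_B ≥ 0`, and the cluster of the `dim ker H_B ≥ 1` lowest eigenvalues is the kernel).
MZ13 §4 Definitions 3 and 5. [folklore] -/
theorem IsProjectorInteraction.iInf_eigenvalues_eq_zero {Φ : Interaction Λ q}
    (h : IsProjectorInteraction Φ) {B : Finset Λ} {g : ℝ} [Nonempty (TensorIndex Λ q)]
    (hgap : (localHamiltonian Φ B).HasClusterGap
      (finrank ℂ (localGroundSpace Φ B)) 0 g) :
    (⨅ j, hgap.isHermitian.eigenvalues j) = 0 := by
  set hA := hgap.isHermitian
  obtain ⟨hA', -, -, hcard, -⟩ := hgap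
  have hnn : ∀ i, 0 ≤ hA.eigenvalues i := (h.posSemidef_localHamiltonian B).eigenvalues_nonneg
  have hbdd : BddBelow (Set.range hA.eigenvalues) := (Set.finite_range _).bddBelow
  -- the cluster is non-empty (it contains a minimiser), so the kernel is non-trivial
  obtain ⟨i₀, hi₀⟩ := exists_eq_ciInf_of_finite (f := hA.eigenvalues)
  have hm : 0 < finrank ℂ (localGroundSpace Φ B) := by
    rw [← hcard, Finset.card_pos]
    exact ⟨i₀, by simp [hi₀]⟩
  -- hence `0` is an eigenvalue
  have hker : finrank ℂ (localGroundSpace Φ B) =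
      #{i | hA.eigenvalues i = 0} := by
    rw [hA.card_filter_eigenvalues_eq, ← h.ker_toLin'_localHamiltonian B,
      ← Module.End.eigenspace_zero]
    simp
  rw [hker, Finset.card_pos] at hm
  obtain ⟨i₁, hi₁⟩ := hm
  simp only [mem_filter, mem_univ, true_and] at hi₁
  exact le_antisymm ((ciInf_le hbdd i₁).trans_eq hi₁) (le_ciInf hnn)

/-- **MZ13 Corollary 1 (1) with the local gap, orthogonal form.** For a projector interaction
with `HasClusterGap H_B (dim localGroundSpace Φ B) 0 g`, every vector orthogonal to the local
ground space satisfies `g‖x‖² ≤ re ⟪x, H_B x⟫`. MZ13 §4 Corollary 1 (1) ("`H_B ≥ ε(1 − P_B(ε))`")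
combined with (4) ("`P_B(ε) = P_B(0)` if `H_B` has spectral gap greater than `ε`").
[cite: MichalakisZwolakCMP2013, §4 Corollary 1 (arXiv:1109.1588 p. 7)] -/
theorem IsProjectorInteraction.mul_norm_sq_le_re_inner_of_mem_orthogonal {Φ : Interaction Λ q}
    (h : IsProjectorInteraction Φ) {B : Finset Λ} {g : ℝ}
    (hgap : (localHamiltonian Φ B).HasClusterGap (finrank ℂ (localGroundSpace Φ B)) 0 g)
    {x : EuclideanSpace ℂ (TensorIndex Λ q)}
    (hx : x ∈ ((localGroundSpace Φ B).map
        ((WithLp.linearEquiv 2 ℂ (TensorIndex Λ q → ℂ)).symm :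
          (TensorIndex Λ q → ℂ) →ₗ[ℂ] EuclideanSpace ℂ (TensorIndex Λ q)))ᗮ) :
    g * ‖x‖ ^ 2 ≤ RCLike.re ⟪x, toEuclideanLin (localHamiltonian Φ B) x⟫_ℂ := by
  rcases isEmpty_or_nonempty (TensorIndex Λ q) with hn | hn
  · have hx0 : x = 0 := Subsingleton.elim _ _
    simp [hx0]
  have h0 := h.iInf_eigenvalues_eq_zero hgap
  have h1 := HasClusterGap.mul_norm_sq_le_re_inner_of_mem_orthogonal hgap (x := x) ?_
  · rwa [h0, zero_add] at h1
  · rw [h0, Complex.ofReal_zero, ← h.map_localGroundSpace_eq_eigenspace B]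
    exact hx

/-- The local ground-state projection acts on `EuclideanSpace` as the orthogonal projection onto
the transported local ground space (`projMatrix_mulVec`). [folklore] -/
theorem toEuclideanLin_localGroundProj (Φ : Interaction Λ q) (B : Finset Λ)
    (x : EuclideanSpace ℂ (TensorIndex Λ q)) :
    toEuclideanLin (localGroundProj Φ B) x =
      ((localGroundSpace Φ B).map
        ((WithLp.linearEquiv 2 ℂ (TensorIndex Λ q → ℂ)).symm :
          (TensorIndex Λ q → ℂ) →ₗ[ℂ] EuclideanSpace ℂ (TensorIndex Λ q))).starProjection x := by
  apply WithLp.ofLp_injective 2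
  rw [toLpLin_apply, WithLp.ofLp_toLp]
  exact projMatrix_mulVec _ x

/-- **MZ13 Corollary 1 (1) with the local gap, projector form: `H_B ≥ g (1 − P_B)`.** For a
projector interaction with `HasClusterGap H_B (dim localGroundSpace Φ B) 0 g` and every vector
`x`: `g ‖x − P_B x‖² ≤ re ⟪x, H_B x⟫` (`H_B P_B = 0`, so only the component orthogonal to the
local ground space contributes). MZ13 §4 Corollary 1 (1) with Definition 5 (Local-Gap:
"`P_{b_u(r)}(γ(r)) = P_{b_u(r)}`"), arXiv:1109.1588 pp. 7–8; used in §6, proof of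
Proposition 2 (p. 14: "`H_{b_{j,a}(r)} ≥ γ_{j,a}(r)(1 − P_{b_{j,a}(r)})`").
[cite: MichalakisZwolakCMP2013, §4 Corollary 1 and Definition 5 (arXiv:1109.1588 pp. 7–8)] -/
theorem IsProjectorInteraction.re_inner_localHamiltonian_ge {Φ : Interaction Λ q}
    (h : IsProjectorInteraction Φ) {B : Finset Λ} {g : ℝ}
    (hgap : (localHamiltonian Φ B).HasClusterGap (finrank ℂ (localGroundSpace Φ B)) 0 g)
    (x : EuclideanSpace ℂ (TensorIndex Λ q)) :
    g * ‖x - toEuclideanLin (localGroundProj Φ B) x‖ ^ 2 ≤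
      RCLike.re ⟪x, toEuclideanLin (localHamiltonian Φ B) x⟫_ℂ := by
  set K : Submodule ℂ (EuclideanSpace ℂ (TensorIndex Λ q)) := (localGroundSpace Φ B).map
    ((WithLp.linearEquiv 2 ℂ (TensorIndex Λ q → ℂ)).symm :
      (TensorIndex Λ q → ℂ) →ₗ[ℂ] EuclideanSpace ℂ (TensorIndex Λ q)) with hK
  set H := localHamiltonian Φ B with hH
  set y : EuclideanSpace ℂ (TensorIndex Λ q) := K.starProjection x with hy
  set z : EuclideanSpace ℂ (TensorIndex Λ q) := x - y with hz
  have hPx : toEuclideanLin (localGroundProj Φ B) x = y := toEuclideanLin_localGroundProj Φ B x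
  have hyK : y ∈ K := K.starProjection_apply_mem x
  have hzK : z ∈ Kᗮ := K.sub_starProjection_mem_orthogonal x
  -- `H y = 0`
  have hHy : toEuclideanLin H y = 0 := by
    have : y ∈ Module.End.eigenspace (toEuclideanLin H) 0 := by
      rw [← h.map_localGroundSpace_eq_eigenspace B]
      exact hyK
    rw [Module.End.mem_eigenspace_iff, zero_smul] at this
    exact this
  have hsym : (toEuclideanLin H).IsSymmetric :=
    isSymmetric_toEuclideanLin_iff.mpr hgap.isHermitian
  have hx : x = z + y := by rw [hz, sub_add_cancel]
  have hform : ⟪x, toEuclideanLin H x⟫_ℂ = ⟪z, toEuclideanLin H z⟫_ℂ := by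
    conv_lhs => rw [hx]
    rw [map_add, hHy, add_zero, inner_add_left, ← hsym y z, hHy, inner_zero_left, add_zero]
  rw [hPx, hform]
  exact h.mul_norm_sq_le_re_inner_of_mem_orthogonal hgap hzK

end LocalGap

/-! ### LTQO transfer to larger regions -/

section Transfer

variable {n : Type*} [Fintype n] [DecidableEq n]

/-- An orthogonal projection has operator norm `≤ 1` (`‖Pᴴ P‖ = ‖P‖²` and `Pᴴ P = P`).
[folklore] -/
theorem norm_le_one_of_isHermitian_of_isIdempotentElem {P : Matrix n n ℂ} (hP : P.IsHermitian)
    (hP2 : P * P = P) : ‖P‖ ≤ 1 := by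
  have h1 := l2_opNorm_conjTranspose_mul_self P
  rw [hP.eq, hP2] at h1
  -- `‖P‖ = ‖P‖ * ‖P‖`
  by_contra hlt
  rw [not_le] at hlt
  have hpos : 0 < ‖P‖ := one_pos.trans hlt
  have : ‖P‖ * 1 < ‖P‖ * ‖P‖ := mul_lt_mul_of_pos_left hlt hpos
  rw [mul_one, ← h1] at this
  exact lt_irrefl _ this

/-- **Transfer of an LTQO-type estimate along nested projections.** If `P` and `P'` are
orthogonal projections with `P' P = P'` (the range of `P'` lies in the range of `P`, as for the
local ground-state projections of nested regions, `localGroundProj_mul_of_subset_holds`), then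
`‖P O P − c P‖ ≤ η` implies `‖P' O P' − c P'‖ ≤ η`: sandwich by `P'` and use `‖P'‖ ≤ 1`.
This is how Local-TQO on a ball is used for the global ground-state projection in MZ13
Lemma 3 (arXiv:1109.1588 p. 12). [folklore] -/
theorem norm_conj_sub_smul_le_of_mul_eq {P P' O : Matrix n n ℂ} (hP : P.IsHermitian)
    (hP' : P'.IsHermitian) (hP'2 : P' * P' = P') (hP'P : P' * P = P') {c : ℂ} {η : ℝ}
    (h : ‖P * O * P - c • P‖ ≤ η) :
    ‖P' * O * P' - c • P'‖ ≤ η := by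
  have hPP' : P * P' = P' := by
    have h1 := congrArg conjTranspose hP'P
    rwa [conjTranspose_mul, hP.eq, hP'.eq] at h1
  have hid : P' * (P * O * P - c • P) * P' = P' * O * P' - c • P' := by
    rw [Matrix.mul_sub, Matrix.sub_mul, Matrix.mul_smul, Matrix.smul_mul, hP'P,
      ← Matrix.mul_assoc, ← Matrix.mul_assoc, hP'P, Matrix.mul_assoc _ P P', hPP', hP'2]
  rw [← hid]
  have h1 := norm_le_one_of_isHermitian_of_isIdempotentElem hP' hP'2
  have h0 : 0 ≤ ‖P * O * P - c • P‖ := norm_nonneg _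
  calc ‖P' * (P * O * P - c • P) * P'‖
      ≤ ‖P' * (P * O * P - c • P)‖ * ‖P'‖ := l2_opNorm_mul _ _
    _ ≤ ‖P'‖ * ‖P * O * P - c • P‖ * ‖P'‖ :=
        mul_le_mul_of_nonneg_right (l2_opNorm_mul _ _) (norm_nonneg _)
    _ ≤ 1 * ‖P * O * P - c • P‖ * 1 := by
        gcongr
    _ ≤ η := by simpa using h

variable {d L : ℕ} [NeZero L] {κ : Type*} [Fintype κ] [DecidableEq κ] {q : ℕ}

/-- **LTQO transfers to every region containing the ball.** If `Φ` has LTQO with rate `Δ` on the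
decorated torus, `O` is supported in `B(x, r)` and `2(r + ℓ) < L`, then for every region
`B' ⊇ B(x, r + ℓ)` (a larger, possibly wrapping ball, or the whole torus)
`‖P_{B'} O P_{B'} − c_ℓ(O) P_{B'}‖ ≤ ‖O‖ Δ ℓ` with the *local* constant
`c_ℓ(O) = tr(P_{B(x,r+ℓ)} O)/tr P_{B(x,r+ℓ)}`, because `P_{B'} P_{B(x,r+ℓ)} = P_{B'}`
(`localGroundProj_mul_of_subset_holds`). For frustration-free projector Hamiltonians `P_univ`
is the ground-state projection `P₀` of `H₀`, so this is the global indistinguishability used in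
MZ13 Lemma 3 (arXiv:1109.1588 p. 12, "From Local-TQO we know that … `‖P₀ X̃_u(r) P₀‖ ≤
‖X_u(r)‖ Δ₀(L − r)`"), here with the rate evaluated at a non-wrapping scale `ℓ`.
[cite: MichalakisZwolakCMP2013, §4 Definition 4 and §5 Lemma 3 (arXiv:1109.1588 pp. 7, 12)] -/
theorem HasLTQO.norm_conj_sub_smul_le_of_subset {Φ : Interaction (TorusSite d L × κ) q}
    {Δ : ℕ → ℝ} (h : HasLTQO Φ Δ) {x : TorusSite d L} {r ℓ : ℕ}
    {O : Op (TorusSite d L × κ) q} (hO : IsSupportedOn O (cellBall x r)) (hL : 2 * (r + ℓ) < L)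
    {B' : Finset (TorusSite d L × κ)} (hB' : cellBall x (r + ℓ) ⊆ B') :
    ‖localGroundProj Φ B' * O * localGroundProj Φ B' -
        ltqoConst (localGroundProj Φ (cellBall x (r + ℓ))) O • localGroundProj Φ B'‖ ≤
      ‖O‖ * Δ ℓ :=
  norm_conj_sub_smul_le_of_mul_eq (localGroundProj_isHermitian Φ _)
    (localGroundProj_isHermitian Φ B') (localGroundProj_idempotent Φ B').eq
    (localGroundProj_mul_of_subset_holds Φ hB') (h x r ℓ O hO hL)

end Transfer

end Literature.MathematicalPhysics.QuantumLattice
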